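import Mathlib.NumberTheory.Padics.PadicNumbers
import Mathlib.NumberTheory.Bernoulli
import Mathlib.NumberTheory.LSeries.HurwitzZetaValues
import Mathlib.Analysis.SpecialFunctions.Pow.Real
import HarnessLib

/-!
# `p`-adic zeta values `ζ_p(s) = L_p(s, ω^{1−s})` (`s ≥ 2`), `p`-adic irrationality and its measure

Topic `Literature/NumberTheory/Irrationality/PAdicZetaValues`. DEFINITIONS (with bodies) and small PROVED API —
the common vocabulary of the sibling files `SmallPrimes.lean` / `Asymptotic.lean`, which TYPE the printed
irrationality results on the values of the Kubota–Leopoldt `p`-adic zeta function at positive integers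
(Calegari 2005; Sprang 2020; Lai 2023/2025; Lai–Sprang 2026; Lai–Lupu–Sprang 2025; Calegari–Dimitrov–Tang 2025;
Lai–Sprang–Zudilin 2026). Mathlib and the tree have no Kubota–Leopoldt `L_p(s, χ)` (the tree's
`PAdicPolylogarithms.ColemanPolylogarithm` documents this gap too); what every one of these sources USES as the
definition of `ζ_p(s)` at an integer `s ≥ 2` is the `p`-adic interpolation of the values at negative integers,
and that is what is defined here, over Mathlib objects only:

* [LaiSprang2026, (1.1), p. 3]: "it follows from the Kummer congruences that the value for positive integers `s`
  can be obtained by a process of `p`-adic interpolation from classical zeta values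
  `ζ_p(s) = lim_{k → s p-adically, k ∈ ℤ_{<0}, k ≡ s mod (p−1)} ζ(k)`, for `s ∈ ℤ_{>1}`. Note that (1.1) implies
  `ζ_p(2n) = 0` for `n ∈ ℤ_{>0}`", after "we define the `p`-adic zeta value `ζ_p(s) := L_p(s, ω^{1−s})`, where `ω`
  is the `p`-adic Teichmüller character and `L_p(s, χ)` is the Kubota–Leopoldt `p`-adic `L`-function. This
  definition is justified by the fact that `ζ_p(s) = (1 − p^{−s}) ζ(s)` for `s ∈ ℤ_{<0}`" (p. 2);
* [Sprang2020, display after Cor. 1.2]: "`ζ_p(s) := L_p(s, ω^{1−s}) = lim_{k → s} ζ(k)`, for `s ∈ ℤ_{>1}`, where `k`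
  runs over a sequence of negative integers which are congruent to `s` modulo `p − 1` and converge `p`-adically
  to `s`, see [calegari]";
* [CalegariDimitrovTang2025Effective, §5.2, (limitdef)]: "`ζ_p(1+2k) = lim_{m → k} ζ^*(1+2m)`, where the limit is
  over `m ∈ ℤ` subject to the condition that `2m ≡ 2k mod p−1` and the topology on `ℤ` is induced from the
  inclusion `ℤ ⊂ ℤ_p`. One can view (limitdef) as interpolating the Kummer congruences on the Bernoulli
  numbers", with "`ζ^*(s) = (1 − p^{−s}) ζ(s)` for the `p`-deprived zeta function" and, for negative `k`,
  "`ζ_p(1+2k) = ζ^*(1+2k)`";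
* [Lai2025TwoAdicZeta, §1 p. 2 and §2.3]: "for an integer `s ≥ 2`, we define `ζ_p(s) := L_p(s, ω^{1−s})` … In this
  notation we have `ζ_p(s) = lim_{k → s p-adically, k ∈ ℤ_{<0}, k ≡ s (mod p−1)} ζ(k) ∈ ℚ_p`, and `ζ_p(s)` vanishes
  when `s` is a positive even integer."

## Contents

* `zetaNeg p m = −(1 − p^{m−1}) B_m / m ∈ ℚ` — for `m ≥ 2` this is `ζ_p(1 − m) = (1 − p^{−(1−m)}) ζ(1 − m)`, the
  value of the `p`-deprived zeta function `ζ^*` at the negative integer `1 − m` (Euler: `ζ(1 − m) = −B_m/m`);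
  PROVED: `zetaNeg_succ_eq_riemannZeta` (`zetaNeg p (k+1) = (1 − p^k) ζ(−k)` in `ℂ`, from Mathlib's
  `riemannZeta_neg_nat_eq_bernoulli'`), `zetaNeg_eq_zero_of_odd`.
* `interpIndex p s N = (p − 1) p^{N+s} + 1 − s` — an explicit sequence of integers `m_N ≥ 2` with
  `m_N ≡ 1 − s (mod (p − 1) p^N)`, i.e. `k_N := 1 − m_N` is a negative integer, `k_N ≡ s (mod p − 1)` and
  `k_N → s` `p`-adically (PROVED: `interpIndex_spec`, `two_le_interpIndex`, `dvd_interpIndex_add_sub_one`,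
  `odd_interpIndex`).
* `padicZetaValue p s : ℚ_[p]` — **`ζ_p(s)`** `:= lim_{N → ∞} ζ_p(k_N) = lim_N zetaNeg p (interpIndex p s N)` in `ℚ_p`,
  rendered with `limUnder atTop`. FAITHFULNESS / JUNK: by the continuity of `L_p(·, ω^{1−s})` on its domain
  [Lai2025TwoAdicZeta, §2.3; Washington, Thm 5.11] the sequence converges and its limit is `L_p(s, ω^{1−s})`, the
  common value of the three displayed limits above (they range over ALL admissible `k`; we fix one cofinal
  sequence, and `(1 − p^{m_N − 1}) → 1` `p`-adically, so the `p`-deprived and the plain values `ζ(k_N)` have the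
  same limit). Convergence is NOT proved in this file (the tree proves the Kummer congruences only off the
  branch `p − 1 ∣ m`, `Congruences/BernoulliKummerCongruence.lean`); should the sequence diverge, `limUnder` would
  return an unspecified value — the named facts of the sibling files are about the printed `ζ_p(s)` under this
  identification. For `s = 0, 1` the definition is junk (`ζ_p` has a pole at `1`). PROVED: `padicZetaValue_even`
  (`ζ_p(s) = 0` for even `s ≥ 2`, as in (1.1): every term vanishes since `m_N` is odd).
* `IsIrrational p ξ` — "an element `η ∈ ℚ_p` is irrational if it does not lie in `ℚ`" [Calegari2005, §2.1].
* `IrrationalityExponentLE p ξ c` — "`μ(ξ) ≤ c`" for the `p`-ADIC IRRATIONALITY MEASURE of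
  [LaiSprangZudilin2026, Def. 2.2]: "`μ(ξ)` — the supremum of the set of real numbers `μ` such that
  `0 < |ξ − A/B|_p < 1/max{|A|, |B|}^μ` is satisfied by infinitely many pairs `(A, B) ∈ ℤ × ℤ_{>0}`"; rendered
  without `sSup` as: for every `μ > c` only finitely many such pairs (equivalent to `sup ≤ c`).

NOT defined here (recorded gaps): the Kubota–Leopoldt function `L_p(s, χ)` for a general Dirichlet character and
the `p`-adic Hurwitz zeta function `ζ_p(s, x)` (Volkenborn integral `(s−1)^{-1} ∫_{ℤ_p} ⟨t + x⟩^{1−s} dt`,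
[Lai2025TwoAdicZeta, §2.3; Sprang2020, §1]); results printed for those objects (Calegari 2005 Thm 4.2 on
`L_2(2, χ_4)`, Beukers 2008, Bel 2010/2019, Sprang 2020 Thms 1.1/1.3, Lai 2025 Thms 1.2–1.3) are therefore not
typed in this topic yet.

Cell zeta5-irr (HONEST FRAMING: systematic search; no irrationality claim unless certified): vocabulary for the
`p`-adic RECORD entries; nothing here bears on `ζ(5) ∈ ℝ`.
-/

noncomputable section

open Filter
open scoped Topology

namespace Literature.NumberTheory.Irrationality.PAdicZetaValues

/-! ### The values at negative integers: `ζ_p(1 − m) = −(1 − p^{m−1}) B_m/m` -/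

/-- `ζ_p(1 − m) := (1 − p^{−(1−m)}) ζ(1 − m) = −(1 − p^{m−1}) B_m / m ∈ ℚ` for an integer `m ≥ 2` — the value of the
`p`-deprived zeta function `ζ^*(s) = (1 − p^{−s}) ζ(s)` at `s = 1 − m` ("It is a classical result of Euler and
Riemann that for non-negative integers `k`, `ζ(1 − 2k) = −B_{2k}/2k` … Let `ζ^*_p(s) = (1 − p^{−s}) ζ(s)`. It is a
consequence of the Kummer congruences that the values `ζ^*_p(s)` at negative odd integers `p`-adically
interpolate"). For `m = 0, 1` the value is junk. [cite: Calegari2005, §2.2] [cite: LaiSprang2026, §1 p. 2 (display `ζ_p(s) = (1 − p^{−s}) ζ(s)`, `s ∈ ℤ_{<0}`)] -/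
def zetaNeg (p m : ℕ) : ℚ := -(1 - (p : ℚ) ^ (m - 1)) * bernoulli m / m

/-- `ζ_p(1 − m) = 0` for odd `m ≥ 3` (`B_m = 0`). [cite: LaiSprang2026, §1 (1.1) ("`ζ_p(2n) = 0`")] -/
theorem zetaNeg_eq_zero_of_odd (p : ℕ) {m : ℕ} (hm : Odd m) (h1 : 1 < m) : zetaNeg p m = 0 := by
  simp [zetaNeg, bernoulli_eq_zero_of_odd hm h1]

/-- Faithfulness to Mathlib's Riemann zeta function: for `k ≥ 1`, `zetaNeg p (k + 1) = (1 − p^k) ζ(−k)`, i.e.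
`ζ_p(s) = (1 − p^{−s}) ζ(s)` at the negative integer `s = −k` (Euler–Riemann `ζ(−k) = −B_{k+1}/(k+1)`, Mathlib
`riemannZeta_neg_nat_eq_bernoulli'`). [cite: LaiSprang2026, §1 p. 2] [cite: Calegari2005, §2.2] -/
theorem zetaNeg_succ_eq_riemannZeta (p k : ℕ) (hk : k ≠ 0) :
    ((zetaNeg p (k + 1) : ℚ) : ℂ) = (1 - (p : ℂ) ^ k) * riemannZeta (-(k : ℂ)) := by
  rw [riemannZeta_neg_nat_eq_bernoulli', zetaNeg, bernoulli_eq_bernoulli'_of_ne_one (by omega),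
    Nat.add_sub_cancel]
  push_cast
  ring

/-! ### The interpolating sequence `m_N = (p − 1) p^{N+s} + 1 − s` -/

/-- `m_N(p, s) = (p − 1) p^{N+s} + 1 − s` (natural-number subtraction; for `p ≥ 2` no truncation occurs,
`interpIndex_spec`): `k_N = 1 − m_N` is a negative integer with `k_N ≡ s (mod (p − 1) p^N)`, so `k_N → s`
`p`-adically along `k_N ≡ s (mod p − 1)` — one explicit cofinal choice in "`k` runs over a sequence of negative
integers which are congruent to `s` modulo `p − 1` and converge `p`-adically to `s`". [cite: Sprang2020, display after Cor. 1.2] -/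
def interpIndex (p s N : ℕ) : ℕ := (p - 1) * p ^ (N + s) + 1 - s

/-- `s < 2^s ≤ p^{N+s}` for `p ≥ 2` (plumbing). [folklore] -/
private theorem lt_pow_add_of_two_le {p : ℕ} (hp : 2 ≤ p) (s N : ℕ) : s < p ^ (N + s) := by
  calc s < 2 ^ s := Nat.lt_two_pow_self
    _ ≤ p ^ s := Nat.pow_le_pow_left hp s
    _ ≤ p ^ (N + s) := Nat.pow_le_pow_right (by omega) (by omega)

/-- No truncation: `m_N + s = (p − 1) p^{N+s} + 1` (`p ≥ 2`). [cite: Sprang2020, display after Cor. 1.2] -/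
theorem interpIndex_add {p : ℕ} (hp : 2 ≤ p) (s N : ℕ) :
    interpIndex p s N + s = (p - 1) * p ^ (N + s) + 1 := by
  have h1 : s < p ^ (N + s) := lt_pow_add_of_two_le hp s N
  have h2 : p ^ (N + s) ≤ (p - 1) * p ^ (N + s) := Nat.le_mul_of_pos_left _ (by omega)
  unfold interpIndex
  generalize p ^ (N + s) = q at h1 h2 ⊢
  generalize (p - 1) * q = r at h2 ⊢
  omega

/-- No truncation: `m_N = (p − 1) p^{N+s} + 1 − s` as integers (`p ≥ 2`). [cite: Sprang2020, display after Cor. 1.2] -/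
theorem interpIndex_spec {p : ℕ} (hp : 2 ≤ p) (s N : ℕ) :
    (interpIndex p s N : ℤ) = (p - 1 : ℤ) * (p : ℤ) ^ (N + s) + 1 - s := by
  have h := interpIndex_add hp s N
  have hp1 : ((p - 1 : ℕ) : ℤ) = (p : ℤ) - 1 := by omega
  have h' : ((interpIndex p s N + s : ℕ) : ℤ) = (((p - 1) * p ^ (N + s) + 1 : ℕ) : ℤ) := by rw [h]
  push_cast [hp1] at h'
  linarith

/-- `m_N ≥ 2`. [cite: Sprang2020, display after Cor. 1.2] -/
theorem two_le_interpIndex {p : ℕ} (hp : 2 ≤ p) (s N : ℕ) : 2 ≤ interpIndex p s N := by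
  have h1 : s < p ^ (N + s) := lt_pow_add_of_two_le hp s N
  have h2 : p ^ (N + s) ≤ (p - 1) * p ^ (N + s) := Nat.le_mul_of_pos_left _ (by omega)
  have h := interpIndex_add hp s N
  generalize p ^ (N + s) = q at h1 h2 h
  generalize (p - 1) * q = r at h2 h
  omega

/-- `m_N + s − 1 = (p − 1) p^{N+s}`: hence `(p − 1) p^N ∣ m_N − (1 − s)`, i.e. `m_N ≡ 1 − s` both modulo `p − 1`
and modulo `p^N`. [cite: Sprang2020, display after Cor. 1.2] [cite: LaiSprang2026, (1.1)] -/
theorem interpIndex_add_sub_one {p : ℕ} (hp : 2 ≤ p) (s N : ℕ) :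
    interpIndex p s N + s - 1 = (p - 1) * p ^ (N + s) := by
  have h := interpIndex_add hp s N
  omega

/-- `(p − 1) p^N ∣ m_N + s − 1` (`= m_N − k` with `k = 1 − s`). [cite: LaiSprang2026, (1.1)] -/
theorem dvd_interpIndex_add_sub_one {p : ℕ} (hp : 2 ≤ p) (s N : ℕ) :
    (p - 1) * p ^ N ∣ interpIndex p s N + s - 1 := by
  rw [interpIndex_add_sub_one hp, pow_add]
  exact ⟨p ^ s, by ring⟩

/-- For even `s ≥ 2` every `m_N` is odd (for odd `p`, `p − 1` is even; for `p = 2`, `2 ∣ p^{N+s}`).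
[cite: LaiSprang2026, (1.1) ("Note that (1.1) implies `ζ_p(2n) = 0`")] -/
theorem odd_interpIndex {p : ℕ} (hp : 2 ≤ p) {s : ℕ} (hs : Even s) (hs0 : s ≠ 0) (N : ℕ) :
    Odd (interpIndex p s N) := by
  have h := interpIndex_add hp s N
  have heven : Even ((p - 1) * p ^ (N + s)) := by
    rcases Nat.even_or_odd p with hp2 | hp2
    · exact (Nat.even_pow.mpr ⟨hp2, by omega⟩).mul_left _
    · exact (Nat.Odd.sub_odd hp2 odd_one).mul_right _
  have hodd : Odd (interpIndex p s N + s) := by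
    rw [h]; exact heven.add_one
  rcases Nat.even_or_odd (interpIndex p s N) with hm | hm
  · exact absurd (hm.add hs) (Nat.not_even_iff_odd.mpr hodd)
  · exact hm

variable (p : ℕ) [Fact p.Prime]

/-! ### `ζ_p(s)` -/

/-- **The `p`-adic zeta value `ζ_p(s) = L_p(s, ω^{1−s}) ∈ ℚ_p`** at an integer `s ≥ 2`, AS the `p`-adic limit of
the values at negative integers: `ζ_p(s) = lim_{N → ∞} ζ_p(k_N)`, `k_N = 1 − m_N → s` `p`-adically, `k_N < 0`,
`k_N ≡ s (mod p − 1)`, `ζ_p(k_N) = (1 − p^{−k_N}) ζ(k_N) = −(1 − p^{m_N−1}) B_{m_N}/m_N` ("`ζ_p(s) := L_p(s, ω^{1−s})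
= lim_{k → s} ζ(k)`, for `s ∈ ℤ_{>1}`, where `k` runs over a sequence of negative integers which are congruent to
`s` modulo `p − 1` and converge `p`-adically to `s`"; the factor `1 − p^{m_N − 1} → 1` `p`-adically). Rendered by
`limUnder atTop` of the explicit sequence (junk if divergent — see the module docstring; convergence and the
identification with the Kubota–Leopoldt value are the cited interpolation property, not proved here); junk for
`s ≤ 1`. [cite: Sprang2020, Cor. 1.2 (display following it)] [cite: LaiSprang2026, §1 (1.1) p. 3] [cite: CalegariDimitrovTang2025Effective, §5.2 (limitdef)] -/
def padicZetaValue (s : ℕ) : ℚ_[p] :=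
  limUnder atTop fun N : ℕ => ((zetaNeg p (interpIndex p s N) : ℚ) : ℚ_[p])

/-- Unfolding. [cite: LaiSprang2026, §1 (1.1)] -/
theorem padicZetaValue_def (s : ℕ) :
    padicZetaValue p s = limUnder atTop fun N : ℕ => ((zetaNeg p (interpIndex p s N) : ℚ) : ℚ_[p]) := rfl

/-- `ζ_p(s) = 0` for even `s ≥ 2` ("Note that (1.1) implies `ζ_p(2n) = 0` for `n ∈ ℤ_{>0}`"; "`ζ_p(s)` vanishes when
`s` is a positive even integer"): every term of the defining sequence is `ζ_p(1 − m_N)` with `m_N` odd, hence `0`.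
[cite: LaiSprang2026, §1 (1.1)] [cite: Lai2025TwoAdicZeta, §1] -/
theorem padicZetaValue_even {s : ℕ} (hs : Even s) (hs0 : s ≠ 0) : padicZetaValue p s = 0 := by
  have hp : 2 ≤ p := (Fact.out : p.Prime).two_le
  have hterm : (fun N : ℕ => ((zetaNeg p (interpIndex p s N) : ℚ) : ℚ_[p])) = fun _ => 0 := by
    funext N
    rw [zetaNeg_eq_zero_of_odd p (odd_interpIndex hp hs hs0 N) (two_le_interpIndex hp s N), Rat.cast_zero]
  rw [padicZetaValue, hterm]
  exact tendsto_const_nhds.limUnder_eq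

/-! ### Irrationality in `ℚ_p` and the `p`-adic irrationality measure -/

/-- "An element `η ∈ ℚ_p` is irrational if it does not lie in `ℚ`." [cite: Calegari2005, §2.1] -/
def IsIrrational (ξ : ℚ_[p]) : Prop := ξ ∉ Set.range ((↑) : ℚ → ℚ_[p])

/-- Unfolding: `ξ` is irrational iff it is not the image of a rational number. [cite: Calegari2005, §2.1] -/
theorem isIrrational_iff (ξ : ℚ_[p]) : IsIrrational p ξ ↔ ∀ q : ℚ, (q : ℚ_[p]) ≠ ξ := by
  simp [IsIrrational]

/-- A rational number is not irrational. [cite: Calegari2005, §2.1] -/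
theorem not_isIrrational_ratCast (q : ℚ) : ¬ IsIrrational p (q : ℚ_[p]) := by
  simp [IsIrrational]

/-- **"`μ(ξ) ≤ c`"** for the `p`-adic irrationality measure of [LaiSprangZudilin2026, Def. 2.2]: "Let `p` be a prime
and `ξ ∈ ℚ_p`. Define the irrationality measure of `ξ` — again denoted by `μ(ξ)` — to be the supremum of the set
of real numbers `μ` such that `0 < |ξ − A/B|_p < 1/max{|A|, |B|}^μ` is satisfied by infinitely many pairs
`(A, B) ∈ ℤ × ℤ_{>0}`." Rendered as: for every `μ > c`, the set of such pairs is finite (`|·|_p` = Mathlib's norm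
on `ℚ_[p]`, `|p|_p = 1/p`). [cite: LaiSprangZudilin2026, Def. 2.2] -/
def IrrationalityExponentLE (ξ : ℚ_[p]) (c : ℝ) : Prop :=
  ∀ μ : ℝ, c < μ →
    {AB : ℤ × ℤ | 0 < AB.2 ∧ 0 < ‖ξ - (AB.1 : ℚ_[p]) / (AB.2 : ℚ_[p])‖ ∧
      ‖ξ - (AB.1 : ℚ_[p]) / (AB.2 : ℚ_[p])‖ < 1 / ((max |AB.1| |AB.2| : ℤ) : ℝ) ^ μ}.Finite

/-- Monotonicity of the rendering: `μ(ξ) ≤ c` and `c ≤ c'` give `μ(ξ) ≤ c'`. [cite: LaiSprangZudilin2026, Def. 2.2] -/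
theorem IrrationalityExponentLE.mono {ξ : ℚ_[p]} {c c' : ℝ} (h : IrrationalityExponentLE p ξ c) (hcc' : c ≤ c') :
    IrrationalityExponentLE p ξ c' :=
  fun μ hμ => h μ (lt_of_le_of_lt hcc' hμ)

end Literature.NumberTheory.Irrationality.PAdicZetaValues
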